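import Literature.Computability.Complexity.ListFoldChecks
import Literature.Computability.QuantumComplexity.PrattMachine
import Literature.NumberTheory.Primality.FellowsKoblitzCertificates
import HarnessLib

/-!
# A polynomial-time check of the Fellows–Koblitz table of orders (brick assembly)

Family `PQC` / trunk `CplxCore`, machine side of `NumberTheory/Primality/FellowsKoblitz.lean`
(`FK.EntryOK p qs j h`: `h ∣ p − 1`, `j^h ≡ 1 (mod p)`, `gcd((j^{h/q} mod p) − 1, p) = 1` for the listed
`q ∣ h`; `FK.EntriesOK`, `FK.TableOK`, `FK.lcmList`), written in the tree's algebra of `FP` string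
functions exactly as `PrattMachine.lean` (projections `fstF`/`sndF`/`nthF`/`sndPow`, one-bit
conditions, `allFn`, `foldFn` with its total semantics `foldFn_boolPair`; arithmetic leaves
`remFn`, `divFn`, `gcdFn`, `prodFn`, `modExpFn`, `addFn`, `subFn`, `ltFn` of `StackBricks*.lean`).
Everything is in the sub-namespace `FKMachine`; numerals are read by `bitsToNat` and lists by
`Brick.decNil`:

* `entryTestFn ⟨⟨p, qs⟩, ⟨j, h⟩⟩ = [2 ≤ ⟦p⟧ ∧ EntryOK ⟦p⟧ ⟦qs⟧ ⟦j⟧ ⟦h⟧]` (`entryTestFn_eq_true_iff`);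
* `tableStep`, `tableFoldFn`: the left fold over the items `h` of the table with accumulator
  `⟨j, ⟨ℓ, flag⟩⟩ ↦ ⟨j + 1, ⟨lcm ℓ h, flag ∧ entry test⟩⟩` from `⟨2, ⟨1, 1⟩⟩` (`foldl_tableStep`, the flag
  being `entriesFlag` with `entriesFlag_eq_true_iff`; growth `FoldGrowth 9`);
* **`tableTestFn`** on a line item `⟨p, ⟨qs, T⟩⟩`: the fold's flag, the count `2 + #T = |p|^6 + 1`
  (`FK.bound = size^6`, the numeral `p` being canonical), and `¬ ℓ² < ⟦p⟧`; in `FP`, one-bit, and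
  **`tableTestFn_encLine_eq_true_iff`**: on the code of `(p, qs, T)` with `2 ≤ p` it reads
  `TableOK p qs T ∧ p ≤ (lcmList T)²`.

## References

* M. R. Fellows, N. Koblitz, *Self-witnessing polynomial-time complexity and prime factorization*,
  Designs, Codes and Cryptography 2 (1992) 231–235, Lemma 1 (the test; "in polynomial time").
* S. Arora, B. Barak, *Computational Complexity: A Modern Approach*, CUP 2009, §1.3 (closure of
  polynomial time under composition and bounded loops).
-/

namespace Literature.Computability.QuantumComplexity

namespace FKMachine

open _root_.Computability Complexity Complexity.Classes Complexity.Brick Complexity.HashBricks Complexity.Plumb Polynomial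
open Literature.NumberTheory.Primality
open PrattMachine (powIsOneFn powIsOneFn_mem_FP oneBit_powIsOneFn powIsOneFn_eq_true_iff allFn_eq_true_iff
  eqValFn_eq_true_iff ltFn_eq_true_iff)

/-! ### Small lemmas on numerals -/

/-- `isNilFn (encodeNat n) = [n = 0]`. [folklore] -/
theorem isNilFn_encodeNat (n : ℕ) : isNilFn (encodeNat n) = [decide (n = 0)] := by
  simp only [isNilFn, List.cons.injEq, and_true]
  rw [decide_eq_decide]
  constructor
  · intro h; simpa using congrArg bitsToNat h
  · rintro rfl; rfl

/-- `bitsToNat [true] = 1`. [folklore] -/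
@[simp] theorem bitsToNat_true : bitsToNat [true] = 1 := by simp

/-- Reading back written numbers. [folklore] -/
@[simp] theorem map_bitsToNat_map_encodeNat (ns : List ℕ) : (ns.map encodeNat).map bitsToNat = ns := by
  simp [List.map_map, Function.comp_def]

/-- Reading back written numbers (composed form). [folklore] -/
@[simp] theorem map_bitsToNat_comp_encodeNat (ns : List ℕ) : ns.map (bitsToNat ∘ encodeNat) = ns := by
  simp [Function.comp_def]

/-- Reading back written numbers (lambda form). [folklore] -/
@[simp] theorem map_bitsToNat_encodeNat_fun (ns : List ℕ) : ns.map (fun n => bitsToNat (encodeNat n)) = ns := by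
  simp

/-- The code of a list of numbers: `encNats ns = encList (ns.map encodeNat)`. [folklore] -/
def encNats (ns : List ℕ) : List Bool := encList (ns.map encodeNat)

/-- Reading back a coded list of numbers. [folklore] -/
@[simp] theorem map_bitsToNat_decNil_encNats (ns : List ℕ) : (decNil (encNats ns)).map bitsToNat = ns := by
  simp [encNats, List.map_map, Function.comp_def]

/-- `decNil` of a coded list of numbers. [folklore] -/
@[simp] theorem decNil_encNats (ns : List ℕ) : decNil (encNats ns) = ns.map encodeNat := by
  simp [encNats]

/-! ### The entry test -/

/-- Context projections of the gcd test `qGcdTestFn` on `⟨⟨p, ⟨j, h⟩⟩, q⟩`. [folklore] -/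
noncomputable def gP : List Bool → List Bool := fstF ∘ fstF
/-- See `gP`. [folklore] -/
noncomputable def gJ : List Bool → List Bool := nthF 1 ∘ fstF
/-- See `gP`. [folklore] -/
noncomputable def gH : List Bool → List Bool := sndPow 1 ∘ fstF
/-- `⟦j⟧^{⟦h⟧/⟦q⟧} mod ⟦p⟧` (for `⟦p⟧ ≥ 2`). [folklore] -/
noncomputable def gPow : List Bool → List Bool :=
  modExpFn ∘ fanoutFn gJ (fanoutFn (divFn ∘ fanoutFn gH sndF) gP)

/-- **The gcd test** `qGcdTestFn ⟨⟨p, ⟨j, h⟩⟩, q⟩`: `⟦q⟧ ∤ ⟦h⟧`, or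
`gcd((⟦j⟧^{⟦h⟧/⟦q⟧} mod ⟦p⟧) − 1, ⟦p⟧) = 1`. [cite: FellowsKoblitz1992, Lemma 1 (proof)] -/
noncomputable def qGcdTestFn : List Bool → List Bool :=
  orFn (notFn (isNilFn ∘ remFn ∘ fanoutFn gH sndF))
    (eqValFn ∘ fanoutFn (gcdFn ∘ fanoutFn (subFn ∘ fanoutFn gPow (fun _ => [true])) gP) (fun _ => [true]))

/-- `qGcdTestFn ∈ FP`. [folklore] -/
theorem qGcdTestFn_mem_FP : qGcdTestFn ∈ FP := by
  have hP : gP ∈ FP := comp_mem_FP fstF_mem_FP fstF_mem_FP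
  have hJ : gJ ∈ FP := comp_mem_FP (nthF_mem_FP 1) fstF_mem_FP
  have hH : gH ∈ FP := comp_mem_FP (sndPow_mem_FP 1) fstF_mem_FP
  have hPow : gPow ∈ FP := comp_mem_FP modExpFn_mem_FP
    (fanoutFn_mem_FP hJ (fanoutFn_mem_FP (comp_mem_FP divFn_mem_FP (fanoutFn_mem_FP hH sndF_mem_FP)) hP))
  exact orFn_mem_FP (notFn_mem_FP (comp_mem_FP isNilFn_mem_FP (comp_mem_FP remFn_mem_FP (fanoutFn_mem_FP hH sndF_mem_FP))))
    (comp_mem_FP eqValFn_mem_FP (fanoutFn_mem_FP (comp_mem_FP gcdFn_mem_FP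
      (fanoutFn_mem_FP (comp_mem_FP subFn_mem_FP (fanoutFn_mem_FP hPow (const_mem_FP _))) hP)) (const_mem_FP _)))

/-- `qGcdTestFn` is one-bit. [folklore] -/
theorem oneBit_qGcdTestFn : OneBit qGcdTestFn :=
  oneBit_orFn (oneBit_notFn (oneBit_isNilFn.comp _)) (oneBit_eqValFn.comp _)

/-- **Truth of the gcd test** (for a modulus `⟦p⟧ ≥ 2`). [cite: FellowsKoblitz1992, Lemma 1 (proof)] -/
theorem qGcdTestFn_eq_true_iff {p : List Bool} (hp : 2 ≤ bitsToNat p) (j h q : List Bool) :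
    qGcdTestFn (boolPair (boolPair p (boolPair j h)) q) = [true] ↔
      (bitsToNat q ∣ bitsToNat h →
        Nat.gcd (bitsToNat j ^ (bitsToNat h / bitsToNat q) % bitsToNat p - 1) (bitsToNat p) = 1) := by
  rw [qGcdTestFn, PrattMachine.orFn_eq_true_iff (oneBit_notFn (oneBit_isNilFn.comp _)) (oneBit_eqValFn.comp _),
    PrattMachine.notFn_eq_true_iff (oneBit_isNilFn.comp _)]
  simp only [Function.comp_apply, fanoutFn_apply, gP, gJ, gH, gPow, fstF_boolPair, sndF_boolPair,
    nthF_succ_boolPair, nthF_zero, sndPow_succ_boolPair, sndPow_zero, remFn_boolPair, divFn_boolPair,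
    modExpFn_boolPair hp, subFn_boolPair, gcdFn_boolPair, bitsToNat_encodeNat, bitsToNat_true,
    isNilFn_encodeNat, eqValFn_eq_true_iff, List.cons.injEq, and_true, decide_eq_true_eq,
    Nat.dvd_iff_mod_eq_zero]
  tauto

/-- Context projections of the entry test on `⟨⟨p, qs⟩, ⟨j, h⟩⟩`. [folklore] -/
noncomputable def eP : List Bool → List Bool := fstF ∘ fstF
/-- See `eP`. [folklore] -/
noncomputable def eQS : List Bool → List Bool := sndF ∘ fstF
/-- See `eP`. [folklore] -/
noncomputable def eJ : List Bool → List Bool := fstF ∘ sndF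
/-- See `eP`. [folklore] -/
noncomputable def eH : List Bool → List Bool := sndF ∘ sndF
/-- `⟦p⟧ − 1`. [folklore] -/
noncomputable def ePm1 : List Bool → List Bool := subFn ∘ fanoutFn eP (fun _ => [true])

/-- **The entry test** `entryTestFn ⟨⟨p, qs⟩, ⟨j, h⟩⟩`: `⟦h⟧ ∣ ⟦p⟧ − 1`, `2 ≤ ⟦p⟧ ∧ ⟦j⟧^⟦h⟧ mod ⟦p⟧ = 1`,
and the gcd test for every item of `qs`. [cite: FellowsKoblitz1992, Lemma 1 (proof)] -/
noncomputable def entryTestFn : List Bool → List Bool :=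
  andFn (isNilFn ∘ remFn ∘ fanoutFn ePm1 eH)
    (andFn (powIsOneFn ∘ fanoutFn eJ (fanoutFn eH eP))
      (allFn qGcdTestFn ∘ fanoutFn (fanoutFn eP (fanoutFn eJ eH)) eQS))

/-- `entryTestFn ∈ FP`. [cite: AroraBarakCC2009, §1.3] -/
theorem entryTestFn_mem_FP : entryTestFn ∈ FP := by
  have hP : eP ∈ FP := comp_mem_FP fstF_mem_FP fstF_mem_FP
  have hQS : eQS ∈ FP := comp_mem_FP sndF_mem_FP fstF_mem_FP
  have hJ : eJ ∈ FP := comp_mem_FP fstF_mem_FP sndF_mem_FP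
  have hH : eH ∈ FP := comp_mem_FP sndF_mem_FP sndF_mem_FP
  have hPm1 : ePm1 ∈ FP := comp_mem_FP subFn_mem_FP (fanoutFn_mem_FP hP (const_mem_FP _))
  exact andFn_mem_FP (comp_mem_FP isNilFn_mem_FP (comp_mem_FP remFn_mem_FP (fanoutFn_mem_FP hPm1 hH)))
    (andFn_mem_FP (comp_mem_FP powIsOneFn_mem_FP (fanoutFn_mem_FP hJ (fanoutFn_mem_FP hH hP)))
      (comp_mem_FP (allFn_mem_FP qGcdTestFn_mem_FP oneBit_qGcdTestFn)
        (fanoutFn_mem_FP (fanoutFn_mem_FP hP (fanoutFn_mem_FP hJ hH)) hQS)))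

/-- `entryTestFn` is one-bit. [folklore] -/
theorem oneBit_entryTestFn : OneBit entryTestFn :=
  oneBit_andFn (oneBit_isNilFn.comp _) (oneBit_andFn (oneBit_powIsOneFn.comp _) ((oneBit_allFn oneBit_qGcdTestFn).comp _))

/-- **Truth of the entry test**: `2 ≤ ⟦p⟧` and `FK.EntryOK` of the denoted numbers.
[cite: FellowsKoblitz1992, Lemma 1 (proof)] -/
theorem entryTestFn_eq_true_iff (p qs j h : List Bool) :
    entryTestFn (boolPair (boolPair p qs) (boolPair j h)) = [true] ↔
      2 ≤ bitsToNat p ∧ FK.EntryOK (bitsToNat p) ((decNil qs).map bitsToNat) (bitsToNat j) (bitsToNat h) := by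
  rw [entryTestFn, PrattMachine.andFn_eq_true_iff (oneBit_isNilFn.comp _) (oneBit_andFn (oneBit_powIsOneFn.comp _)
      ((oneBit_allFn oneBit_qGcdTestFn).comp _)),
    PrattMachine.andFn_eq_true_iff (oneBit_powIsOneFn.comp _) ((oneBit_allFn oneBit_qGcdTestFn).comp _)]
  simp only [Function.comp_apply, fanoutFn_apply, eP, eQS, eJ, eH, ePm1, fstF_boolPair, sndF_boolPair,
    subFn_boolPair, remFn_boolPair, bitsToNat_encodeNat, bitsToNat_true, isNilFn_encodeNat,
    powIsOneFn_eq_true_iff, allFn_eq_true_iff oneBit_qGcdTestFn, List.cons.injEq, and_true,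
    decide_eq_true_eq, FK.EntryOK, List.forall_mem_map, ← Nat.dvd_iff_mod_eq_zero]
  constructor
  · rintro ⟨hdvd, ⟨h2, hpow⟩, hall⟩
    exact ⟨h2, hdvd, hpow, fun q hq => (qGcdTestFn_eq_true_iff h2 j h q).1 (hall q hq)⟩
  · rintro ⟨h2, hdvd, hpow, hall⟩
    exact ⟨hdvd, ⟨h2, hpow⟩, fun q hq => (qGcdTestFn_eq_true_iff h2 j h q).2 (hall q hq)⟩

/-! ### The table fold -/

/-- `lcmFn ⟨a, b⟩ = encodeNat (lcm ⟦a⟧ ⟦b⟧)` (`lcm = a b / gcd`). [folklore] -/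
noncomputable def lcmFn : List Bool → List Bool := divFn ∘ fanoutFn prodFn gcdFn

/-- `lcmFn ∈ FP`. [folklore] -/
theorem lcmFn_mem_FP : lcmFn ∈ FP := comp_mem_FP divFn_mem_FP (fanoutFn_mem_FP prodFn_mem_FP gcdFn_mem_FP)

/-- Value of `lcmFn`. [folklore] -/
@[simp] theorem lcmFn_boolPair (a b : List Bool) : lcmFn (boolPair a b) = encodeNat (Nat.lcm (bitsToNat a) (bitsToNat b)) := by
  simp [lcmFn, Nat.lcm]

/-- Projections of the table step on step arguments `v = ⟨w, ⟨h, ⟨j, ⟨ℓ, flag⟩⟩⟩⟩`, `w = ⟨⟨p, qs⟩, T⟩`: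
the context `⟨p, qs⟩`. [folklore] -/
noncomputable def sCtx : List Bool → List Bool := fstF ∘ fstF
/-- The item `h`. [folklore] -/
noncomputable def sH : List Bool → List Bool := nthF 1
/-- The counter `j`. [folklore] -/
noncomputable def sJ : List Bool → List Bool := nthF 2
/-- The lcm so far `ℓ`. [folklore] -/
noncomputable def sL : List Bool → List Bool := nthF 3
/-- The flag so far. [folklore] -/
noncomputable def sFlag : List Bool → List Bool := sndPow 3

/-- **The table step**: `⟨j, ⟨ℓ, flag⟩⟩ ↦ ⟨j + 1, ⟨lcm ℓ h, flag ∧ entryTestFn ⟨⟨p, qs⟩, ⟨j, h⟩⟩⟩⟩`.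
[cite: FellowsKoblitz1992, Lemma 1 (proof)] -/
noncomputable def tableStep : List Bool → List Bool :=
  fanoutFn (addFn ∘ fanoutFn sJ (fun _ => [true]))
    (fanoutFn (lcmFn ∘ fanoutFn sL sH)
      (andFn (headBitFn ∘ sFlag) (entryTestFn ∘ fanoutFn sCtx (fanoutFn sJ sH))))

/-- `tableStep ∈ FP`. [cite: AroraBarakCC2009, §1.3] -/
theorem tableStep_mem_FP : tableStep ∈ FP := by
  have hCtx : sCtx ∈ FP := comp_mem_FP fstF_mem_FP fstF_mem_FP
  exact fanoutFn_mem_FP (comp_mem_FP addFn_mem_FP (fanoutFn_mem_FP (nthF_mem_FP 2) (const_mem_FP _)))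
    (fanoutFn_mem_FP (comp_mem_FP lcmFn_mem_FP (fanoutFn_mem_FP (nthF_mem_FP 3) (nthF_mem_FP 1)))
      (andFn_mem_FP (comp_mem_FP headBitFn_mem_FP (sndPow_mem_FP 3))
        (comp_mem_FP entryTestFn_mem_FP (fanoutFn_mem_FP hCtx (fanoutFn_mem_FP (nthF_mem_FP 2) (nthF_mem_FP 1))))))

/-- Value of the table step on a step argument. [folklore] -/
theorem tableStep_apply (ctx T h : List Bool) (j ℓ : ℕ) (b : Bool) :
    tableStep (boolPair (boolPair ctx T) (boolPair h (boolPair (encodeNat j) (boolPair (encodeNat ℓ) [b])))) =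
      boolPair (encodeNat (j + 1)) (boolPair (encodeNat (Nat.lcm ℓ (bitsToNat h)))
        [b && decide (entryTestFn (boolPair ctx (boolPair (encodeNat j) h)) = [true])]) := by
  obtain ⟨b', hb'⟩ := oneBit_entryTestFn (boolPair ctx (boolPair (encodeNat j) h))
  have h1 : (headBitFn ∘ sFlag) (boolPair (boolPair ctx T) (boolPair h (boolPair (encodeNat j) (boolPair (encodeNat ℓ) [b])))) = [b] := by
    simp [sFlag, sndPow]
  have h2 : (entryTestFn ∘ fanoutFn sCtx (fanoutFn sJ sH))
      (boolPair (boolPair ctx T) (boolPair h (boolPair (encodeNat j) (boolPair (encodeNat ℓ) [b])))) = [b'] := by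
    simp only [Function.comp_apply, fanoutFn_apply, sCtx, sJ, sH, fstF_boolPair, nthF_succ_boolPair, nthF_zero]
    exact hb'
  rw [tableStep, fanoutFn_apply, fanoutFn_apply, andFn_apply h1 h2, hb']
  simp [sJ, sL, sH, nthF]

/-- Growth of the table step: `FoldGrowth 9` (the counter grows by one digit at most, the lcm by
the digits of the item). [folklore] -/
theorem foldGrowth_tableStep : FoldGrowth 9 tableStep := by
  intro v
  have hflag : (andFn (headBitFn ∘ sFlag) (entryTestFn ∘ fanoutFn sCtx (fanoutFn sJ sH)) v).length = 1 :=
    (oneBit_andFn (oneBit_headBitFn.comp _) (oneBit_entryTestFn.comp _)).length_eq v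
  have hJ : (addFn (fanoutFn sJ (fun _ => [true]) v)).length ≤ (sJ v).length + 1 + 1 := by
    rw [fanoutFn_apply, addFn_boolPair]
    exact (length_encodeNat_add_le (sJ v) [true]).trans (by simp)
  have hL : (lcmFn (fanoutFn sL sH v)).length ≤ (sL v).length + (sH v).length := by
    rw [fanoutFn_apply, lcmFn_boolPair]
    refine le_trans (length_encodeNat_mono (Nat.div_le_self _ _)) ?_
    exact length_encodeNat_mul_le (sL v) (sH v)
  -- the accumulator `sndF (sndF v) = ⟨j, ⟨ℓ, flag⟩⟩` holds the counter and the lcm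
  have hacc1 := length_fstF_sndF_le (sndF (sndF v))
  have hacc2 := length_fstF_sndF_le (sndF (sndF (sndF v)))
  have eJ' : sJ v = fstF (sndF (sndF v)) := by simp [sJ, nthF]
  have eL' : sL v = fstF (sndF (sndF (sndF v))) := by simp [sL, nthF]
  have eH' : sH v = fstF (sndF v) := by simp [sH, nthF]
  rw [tableStep, fanoutFn_apply, length_boolPair, fanoutFn_apply, length_boolPair, hflag,
    Function.comp_apply, Function.comp_apply]
  rw [eJ'] at hJ
  rw [eL', eH'] at hL
  omega

/-- The flag computed by the fold: the conjunction of the entry tests of the items `hs` from the base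
`j` on. [folklore] -/
noncomputable def entriesFlag (p qs : List Bool) : ℕ → List (List Bool) → Bool
  | _, [] => true
  | j, a :: hs => decide (entryTestFn (boolPair (boolPair p qs) (boolPair (encodeNat j) a)) = [true]) && entriesFlag p qs (j + 1) hs

/-- **Truth of the flag**: all entries pass (`FK.EntriesOK` of the denoted numbers) and, if there is
an entry at all, `2 ≤ ⟦p⟧`. [cite: FellowsKoblitz1992, Lemma 1 (proof)] -/
theorem entriesFlag_eq_true_iff (p qs : List Bool) : ∀ (j : ℕ) (hs : List (List Bool)),
    entriesFlag p qs j hs = true ↔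
      (hs ≠ [] → 2 ≤ bitsToNat p) ∧ FK.EntriesOK (bitsToNat p) ((decNil qs).map bitsToNat) j (hs.map bitsToNat)
  | j, [] => by simp [entriesFlag]
  | j, a :: hs => by
    rw [entriesFlag, Bool.and_eq_true, decide_eq_true_eq, entryTestFn_eq_true_iff, bitsToNat_encodeNat,
      entriesFlag_eq_true_iff p qs (j + 1) hs, List.map_cons, FK.entriesOK_cons]
    constructor
    · rintro ⟨⟨h2, hE⟩, -, hrest⟩
      exact ⟨fun _ => h2, hE, hrest⟩
    · rintro ⟨h2, hE, hrest⟩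
      exact ⟨⟨h2 (by simp), hE⟩, fun _ => h2 (by simp), hrest⟩

/-- The left fold of the table step over coded items, from `⟨j, ⟨ℓ, [b]⟩⟩`: the counter counts the
items, the lcm accumulates, and the flag conjoins the entry tests. [folklore] -/
theorem foldl_tableStep (p qs T : List Bool) : ∀ (hs : List (List Bool)) (j ℓ : ℕ) (b : Bool),
    hs.foldl (fun acc a => tableStep (boolPair (boolPair (boolPair p qs) T) (boolPair a acc)))
        (boolPair (encodeNat j) (boolPair (encodeNat ℓ) [b])) =
      boolPair (encodeNat (j + hs.length))
        (boolPair (encodeNat ((hs.map bitsToNat).foldl Nat.lcm ℓ)) [b && entriesFlag p qs j hs])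
  | [], j, ℓ, b => by simp [entriesFlag]
  | a :: hs, j, ℓ, b => by
    rw [List.foldl_cons, tableStep_apply, foldl_tableStep p qs T hs (j + 1)]
    simp only [List.length_cons, List.map_cons, List.foldl_cons, entriesFlag, Bool.and_assoc]
    congr 2
    omega

/-- The initial accumulator `⟨2, ⟨1, [1]⟩⟩`. [folklore] -/
def tableIni : List Bool := boolPair (encodeNat 2) (boolPair (encodeNat 1) [true])

/-- **The table fold** on `⟨⟨p, qs⟩, T⟩`. [cite: FellowsKoblitz1992, Lemma 1 (proof)] -/
noncomputable def tableFoldFn : List Bool → List Bool := foldFn tableStep (fun _ => tableIni)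

/-- `tableFoldFn ∈ FP`. [cite: AroraBarakCC2009, §1.3] -/
theorem tableFoldFn_mem_FP : tableFoldFn ∈ FP :=
  foldFn_mem_FP tableStep_mem_FP (const_mem_FP _) foldGrowth_tableStep

/-- **Value of the table fold** on `⟨⟨p, qs⟩, T⟩`. [folklore] -/
theorem tableFoldFn_boolPair (p qs T : List Bool) :
    tableFoldFn (boolPair (boolPair p qs) T) =
      boolPair (encodeNat (2 + (decNil T).length))
        (boolPair (encodeNat (FK.lcmList ((decNil T).map bitsToNat))) [entriesFlag p qs 2 (decNil T)]) := by
  rw [tableFoldFn, foldFn_boolPair, show tableIni = boolPair (encodeNat 2) (boolPair (encodeNat 1) [true]) from rfl,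
    foldl_tableStep]
  simp [FK.foldl_lcm_eq]

/-! ### The table test on a line item -/

/-- The re-arrangement of a line item `⟨p, ⟨qs, T⟩⟩` into the fold's input `⟨⟨p, qs⟩, T⟩`. [folklore] -/
noncomputable def tArr : List Bool → List Bool := fanoutFn (fanoutFn (nthF 0) (nthF 1)) (sndPow 1)

/-- The fold's result on a line item. [folklore] -/
noncomputable def tRes : List Bool → List Bool := tableFoldFn ∘ tArr

/-- `encodeNat (|p|^6 + 1)`: one more than `FK.bound` of a canonical numeral `p`. [folklore] -/
noncomputable def boundSuccFn : List Bool → List Bool :=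
  addFn ∘ fanoutFn (lenBinF ∘ polyFn (X ^ 6) ∘ nthF 0) (fun _ => [true])

/-- **The table test** on a line item `⟨p, ⟨qs, T⟩⟩`: all entries pass (the fold's flag), the
number of entries is `|p|^6 − 1`, and `¬ ℓ² < ⟦p⟧` for the lcm `ℓ` of the entries.
[cite: FellowsKoblitz1992, Lemma 1] -/
noncomputable def tableTestFn : List Bool → List Bool :=
  andFn (headBitFn ∘ sndPow 1 ∘ tRes)
    (andFn (eqValFn ∘ fanoutFn (fstF ∘ tRes) boundSuccFn)
      (notFn (ltFn ∘ fanoutFn (prodFn ∘ fanoutFn (nthF 1 ∘ tRes) (nthF 1 ∘ tRes)) (nthF 0))))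

/-- `tableTestFn ∈ FP`. [cite: AroraBarakCC2009, §1.3] -/
theorem tableTestFn_mem_FP : tableTestFn ∈ FP := by
  have hR : tRes ∈ FP := comp_mem_FP tableFoldFn_mem_FP
    (fanoutFn_mem_FP (fanoutFn_mem_FP (nthF_mem_FP 0) (nthF_mem_FP 1)) (sndPow_mem_FP 1))
  have hB : boundSuccFn ∈ FP := comp_mem_FP addFn_mem_FP
    (fanoutFn_mem_FP (comp_mem_FP lenBinF_mem_FP (comp_mem_FP (polyFn_mem_FP _) (nthF_mem_FP 0))) (const_mem_FP _))
  exact andFn_mem_FP (comp_mem_FP headBitFn_mem_FP (comp_mem_FP (sndPow_mem_FP 1) hR))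
    (andFn_mem_FP (comp_mem_FP eqValFn_mem_FP (fanoutFn_mem_FP (comp_mem_FP fstF_mem_FP hR) hB))
      (notFn_mem_FP (comp_mem_FP ltFn_mem_FP (fanoutFn_mem_FP
        (comp_mem_FP prodFn_mem_FP (fanoutFn_mem_FP (comp_mem_FP (nthF_mem_FP 1) hR) (comp_mem_FP (nthF_mem_FP 1) hR)))
        (nthF_mem_FP 0)))))

/-- `tableTestFn` is one-bit. [folklore] -/
theorem oneBit_tableTestFn : OneBit tableTestFn :=
  oneBit_andFn (oneBit_headBitFn.comp _) (oneBit_andFn (oneBit_eqValFn.comp _) (oneBit_notFn (oneBit_ltFn.comp _)))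

/-- The code of a line `(p, qs, T)`: `⟨p, ⟨qs, T⟩⟩` in canonical binary. [folklore] -/
def encLine (l : FK.Line) : List Bool := boolPair (encodeNat l.1) (boolPair (encNats l.2.1) (encNats l.2.2))

/-- **Truth of the table test on the code of a line** with head `p ≥ 2`: `TableOK p qs T` and
`p ≤ (lcmList T)²`. [cite: FellowsKoblitz1992, Lemma 1] -/
theorem tableTestFn_encLine_eq_true_iff {p : ℕ} (hp : 2 ≤ p) (qs T : List ℕ) :
    tableTestFn (encLine (p, qs, T)) = [true] ↔ FK.TableOK p qs T ∧ p ≤ FK.lcmList T ^ 2 := by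
  have hres : tRes (boolPair (encodeNat p) (boolPair (encNats qs) (encNats T))) =
      boolPair (encodeNat (2 + T.length)) (boolPair (encodeNat (FK.lcmList T))
        [entriesFlag (encodeNat p) (encNats qs) 2 (T.map encodeNat)]) := by
    have h0 : tRes (boolPair (encodeNat p) (boolPair (encNats qs) (encNats T))) =
        tableFoldFn (boolPair (boolPair (encodeNat p) (encNats qs)) (encNats T)) := by
      simp [tRes, tArr, sndPow, nthF]
    rw [h0, tableFoldFn_boolPair]
    simp [Function.comp_def]
  have hflag : entriesFlag (encodeNat p) (encNats qs) 2 (T.map encodeNat) = true ↔ FK.EntriesOK p qs 2 T := by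
    rw [entriesFlag_eq_true_iff]
    simp only [bitsToNat_encodeNat, decNil_encNats, map_bitsToNat_map_encodeNat, ne_eq, and_iff_right_iff_imp]
    exact fun _ _ => hp
  rw [tableTestFn, PrattMachine.andFn_eq_true_iff (oneBit_headBitFn.comp _) (oneBit_andFn (oneBit_eqValFn.comp _) (oneBit_notFn (oneBit_ltFn.comp _))),
    PrattMachine.andFn_eq_true_iff (oneBit_eqValFn.comp _) (oneBit_notFn (oneBit_ltFn.comp _)), PrattMachine.notFn_eq_true_iff (oneBit_ltFn.comp _)]
  simp only [Function.comp_apply, fanoutFn_apply, encLine, hres, sndPow_succ_boolPair, sndPow_zero, headBitFn_apply,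
    List.headD_cons, fstF_boolPair, sndF_boolPair, nthF_succ_boolPair, nthF_zero, boundSuccFn, polyFn_apply, lenBinF_apply,
    addFn_boolPair, bitsToNat_encodeNat, bitsToNat_true, eqValFn_eq_true_iff, prodFn_boolPair, ltFn_eq_true_iff, not_lt,
    List.cons.injEq, and_true, hflag, FK.TableOK, FK.bound, eval_pow, eval_X, TM2Pass.length_encodeNat_eq_size,
    List.length_replicate]
  have h1 : 1 ≤ p.size ^ 6 := Nat.one_le_pow 6 p.size (Nat.size_pos.2 (by omega))
  rw [pow_two]
  constructor
  · rintro ⟨hE, hlen, hle⟩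
    exact ⟨⟨by omega, hE⟩, hle⟩
  · rintro ⟨⟨hlen, hE⟩, hle⟩
    exact ⟨hE, by omega, hle⟩

end FKMachine

end Literature.Computability.QuantumComplexity
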